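import Summits.BirchSwinnertonDyer.BirchSwinnertonDyer.Theorems.TwistFamilyManinDescentIsogenyTableFamilyEngine
import HarnessLib

/-!
# Route `TwistFamilyManinDescent`, crux `IsogenyTableFamiliesManinOne` (stmt-BirchSwinnertonDyer-25137): SEVEN of the
# eleven isogeny-table `j`-families certified (`ℓ ∈ {11, 19, 37, 43}`), granted modularity and Cremona `≤ 5·10⁵`

THEOREMS ONLY (`--supports` 25137; the item needs all eleven families and is NOT closed here). For each of the
`j`-invariants `−11²` (121c1), `−2¹⁵` (121b1), `−11·131³` (121a1), `−96³` (361a1), `−960³` (1849a1), `−7·11³`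
(1225h1), `−7·137³·2083³` (1225h2): every elliptic `W/ℚ` with that `j` satisfies `ClassAbsManinConstantEqOne W`,
granted `exists_isNewformOf` and `cremona_abs_maninConstant_eq_one_of_level_le_500000` (the two hypotheses of the
item). Each is ONE application of the family engine `classAbsManinConstantEqOne_of_j_eq_of_disc_support` to an
explicit integral base model (discriminant `−11⁴, −11³, −11², −19³, −43³, −5³7², −5³7²`; the crude conductor bound
`2⁸·∏_{q∈S} q²` is `30976, 30976, 30976, 92416, 473344, 313600, 313600 < 5·10⁵`) with the whole-family descent taken as the
hypothesis `hT` (item 25136, landed as `twistFamilyDescent_proof`; kept as a binder so that no route file is imported). NOT covered (need the exact dyadic exponent, Barrios et al. 2025):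
`−17²·101³/2`, `−17·373³/2¹⁷` (base conductor `2·5²·17²`), `−5280³` (`67²`), `−640320³` (`163²`, odd twists only).
BSD is not proved by this; Manin's conjecture is not proved by this.
-/

-- D-0017: single-problem summit, so `Summit.BirchSwinnertonDyer.BirchSwinnertonDyer.…` repeats a namespace BY DESIGN.
set_option linter.dupNamespace false
set_option autoImplicit false

noncomputable section

open scoped Classical

open WeierstrassCurve Literature.NumberTheory.EllipticCurves Literature.NumberTheory.EllipticCurves.ModularForms

namespace Summit.BirchSwinnertonDyer.BirchSwinnertonDyer.Theorems.TwistFamilyManinDescent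

/-- A prime dividing `±ℓ^k` (`ℓ` prime) is `ℓ`. [elementary] -/
private theorem prime_eq_of_dvd_neg_pow {q ℓ k : ℕ} (hq : q.Prime) (hℓ : ℓ.Prime)
    (h : (q : ℤ) ∣ -((ℓ : ℤ) ^ k)) : q = ℓ := by
  rw [dvd_neg] at h
  have h' : q ∣ ℓ ^ k := by exact_mod_cast h
  exact (Nat.prime_dvd_prime_iff_eq hq hℓ).mp (hq.dvd_of_dvd_pow h')

/-- A prime dividing `-(5³·7²)` is `5` or `7`. [elementary] -/
private theorem prime_mem_of_dvd_6125 {q : ℕ} (hq : q.Prime) (h : (q : ℤ) ∣ -6125) :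
    q ∈ ({5, 7} : Finset ℕ) := by
  rw [dvd_neg, show (6125 : ℤ) = (5 : ℤ) ^ 3 * (7 : ℤ) ^ 2 by norm_num] at h
  have hqZ : Prime (q : ℤ) := Nat.prime_iff_prime_int.mp hq
  simp only [Finset.mem_insert, Finset.mem_singleton]
  rcases hqZ.dvd_or_dvd h with h5 | h7
  · left
    have : q ∣ 5 ^ 3 := by exact_mod_cast hqZ.dvd_of_dvd_pow h5 |>.trans (dvd_pow_self _ three_ne_zero)
    exact (Nat.prime_dvd_prime_iff_eq hq (by norm_num)).mp (hq.dvd_of_dvd_pow this)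
  · right
    have : q ∣ 7 ^ 2 := by exact_mod_cast hqZ.dvd_of_dvd_pow h7 |>.trans (dvd_pow_self _ two_ne_zero)
    exact (Nat.prime_dvd_prime_iff_eq hq (by norm_num)).mp (hq.dvd_of_dvd_pow this)

section Families

variable
  (hT : ∀ (E₀ : WeierstrassCurve ℚ) [E₀.IsElliptic] (A : ℕ),
    (∀ (q : ℕ) [Fact q.Prime], q ≠ 2 → Rank1Residual.Addv E₀ q → q ∣ A) →
    ∀ d₀ d₁ : ℤ, d₀ ≠ 0 → d₁ ≠ 0 → IsCoprime d₁ (2 * A * d₀) →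
    ClassAbsManinConstantEqOne (E₀.quadraticTwist ((d₀ : ℤ) : ℚ)) →
    ClassAbsManinConstantEqOne (E₀.quadraticTwist ((-d₀ : ℤ) : ℚ)) →
    ClassAbsManinConstantEqOne (E₀.quadraticTwist ((d₀ * d₁ : ℤ) : ℚ)))
include hT

/-- **`j = −11²` (base 121c1 `[1,1,0,−2,−7]`, `Δ = −11⁴`): the whole family has the class Manin certificate.**
[cite: CremonaAlgorithms1997, Table 1 (121c1) and §3.8] -/
theorem classAbsManinConstantEqOne_of_j_eq_neg_121
    (hnf : exists_isNewformOf) (hCre : cremona_abs_maninConstant_eq_one_of_level_le_500000)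
    (W : WeierstrassCurve ℚ) [W.IsElliptic] (hj : W.j = -121) :
    ClassAbsManinConstantEqOne W := by
  have hΔ : (⟨1, 1, 0, -2, -7⟩ : WeierstrassCurve ℤ).Δ = -((11 : ℤ) ^ 4) := by
    norm_num [WeierstrassCurve.Δ, WeierstrassCurve.b₂, WeierstrassCurve.b₄, WeierstrassCurve.b₆, WeierstrassCurve.b₈]
  have hc₄ : (⟨1, 1, 0, -2, -7⟩ : WeierstrassCurve ℤ).c₄ = 121 := by
    norm_num [WeierstrassCurve.c₄, WeierstrassCurve.b₂, WeierstrassCurve.b₄]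
  haveI : ((⟨1, 1, 0, -2, -7⟩ : WeierstrassCurve ℤ).baseChange ℚ).IsElliptic :=
    ⟨by rw [WeierstrassCurve.baseChange, WeierstrassCurve.map_Δ, hΔ]; norm_num⟩
  have hjb : ((⟨1, 1, 0, -2, -7⟩ : WeierstrassCurve ℤ).baseChange ℚ).j = -121 := by
    rw [WeierstrassCurve.j, Units.val_inv_eq_inv_val, WeierstrassCurve.coe_Δ', WeierstrassCurve.baseChange,
      WeierstrassCurve.map_Δ, WeierstrassCurve.map_c₄, hΔ, hc₄]
    norm_num [eq_intCast]
  refine classAbsManinConstantEqOne_of_j_eq_of_disc_support hnf hCre hT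
    ⟨1, 1, 0, -2, -7⟩ (by rw [hjb]; norm_num) (by rw [hjb]; norm_num) {11} (by simp; norm_num) (by simp)
    (fun q hq h ↦ Or.inr ?_) (by simp) W (by rw [hjb, hj])
  rw [hΔ] at h
  simp [prime_eq_of_dvd_neg_pow hq (by norm_num) h]

/-- **`j = −2¹⁵` (base 121b1 `[0,−1,1,−7,10]`, `Δ = −11³`).** [cite: CremonaAlgorithms1997, Table 1 (121b1) and §3.8] -/
theorem classAbsManinConstantEqOne_of_j_eq_neg_32768
    (hnf : exists_isNewformOf) (hCre : cremona_abs_maninConstant_eq_one_of_level_le_500000)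
    (W : WeierstrassCurve ℚ) [W.IsElliptic] (hj : W.j = -32768) : ClassAbsManinConstantEqOne W := by
  have hΔ : (⟨0, -1, 1, -7, 10⟩ : WeierstrassCurve ℤ).Δ = -((11 : ℤ) ^ 3) := by
    norm_num [WeierstrassCurve.Δ, WeierstrassCurve.b₂, WeierstrassCurve.b₄, WeierstrassCurve.b₆, WeierstrassCurve.b₈]
  have hc₄ : (⟨0, -1, 1, -7, 10⟩ : WeierstrassCurve ℤ).c₄ = 352 := by
    norm_num [WeierstrassCurve.c₄, WeierstrassCurve.b₂, WeierstrassCurve.b₄]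
  haveI : ((⟨0, -1, 1, -7, 10⟩ : WeierstrassCurve ℤ).baseChange ℚ).IsElliptic :=
    ⟨by rw [WeierstrassCurve.baseChange, WeierstrassCurve.map_Δ, hΔ]; norm_num⟩
  have hjb : ((⟨0, -1, 1, -7, 10⟩ : WeierstrassCurve ℤ).baseChange ℚ).j = -32768 := by
    rw [WeierstrassCurve.j, Units.val_inv_eq_inv_val, WeierstrassCurve.coe_Δ', WeierstrassCurve.baseChange,
      WeierstrassCurve.map_Δ, WeierstrassCurve.map_c₄, hΔ, hc₄]
    norm_num [eq_intCast]
  refine classAbsManinConstantEqOne_of_j_eq_of_disc_support hnf hCre hT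
    ⟨0, -1, 1, -7, 10⟩ (by rw [hjb]; norm_num) (by rw [hjb]; norm_num) {11} (by simp; norm_num) (by simp)
    (fun q hq h ↦ Or.inr ?_) (by simp) W (by rw [hjb, hj])
  rw [hΔ] at h
  simp [prime_eq_of_dvd_neg_pow hq (by norm_num) h]

/-- **`j = −11·131³` (base 121a1 `[1,1,1,−30,−76]`, `Δ = −11²`).** [cite: CremonaAlgorithms1997, Table 1 (121a1) and §3.8] -/
theorem classAbsManinConstantEqOne_of_j_eq_neg_24729001
    (hnf : exists_isNewformOf) (hCre : cremona_abs_maninConstant_eq_one_of_level_le_500000)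
    (W : WeierstrassCurve ℚ) [W.IsElliptic] (hj : W.j = -24729001) : ClassAbsManinConstantEqOne W := by
  have hΔ : (⟨1, 1, 1, -30, -76⟩ : WeierstrassCurve ℤ).Δ = -((11 : ℤ) ^ 2) := by
    norm_num [WeierstrassCurve.Δ, WeierstrassCurve.b₂, WeierstrassCurve.b₄, WeierstrassCurve.b₆, WeierstrassCurve.b₈]
  have hc₄ : (⟨1, 1, 1, -30, -76⟩ : WeierstrassCurve ℤ).c₄ = 1441 := by
    norm_num [WeierstrassCurve.c₄, WeierstrassCurve.b₂, WeierstrassCurve.b₄]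
  haveI : ((⟨1, 1, 1, -30, -76⟩ : WeierstrassCurve ℤ).baseChange ℚ).IsElliptic :=
    ⟨by rw [WeierstrassCurve.baseChange, WeierstrassCurve.map_Δ, hΔ]; norm_num⟩
  have hjb : ((⟨1, 1, 1, -30, -76⟩ : WeierstrassCurve ℤ).baseChange ℚ).j = -24729001 := by
    rw [WeierstrassCurve.j, Units.val_inv_eq_inv_val, WeierstrassCurve.coe_Δ', WeierstrassCurve.baseChange,
      WeierstrassCurve.map_Δ, WeierstrassCurve.map_c₄, hΔ, hc₄]
    norm_num [eq_intCast]
  refine classAbsManinConstantEqOne_of_j_eq_of_disc_support hnf hCre hT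
    ⟨1, 1, 1, -30, -76⟩ (by rw [hjb]; norm_num) (by rw [hjb]; norm_num) {11} (by simp; norm_num) (by simp)
    (fun q hq h ↦ Or.inr ?_) (by simp) W (by rw [hjb, hj])
  rw [hΔ] at h
  simp [prime_eq_of_dvd_neg_pow hq (by norm_num) h]

/-- **`j = −96³` (base 361a1 `[0,0,1,−38,90]`, `Δ = −19³`).** [cite: CremonaAlgorithms1997, Table 1 (361a1) and §3.8] -/
theorem classAbsManinConstantEqOne_of_j_eq_neg_884736
    (hnf : exists_isNewformOf) (hCre : cremona_abs_maninConstant_eq_one_of_level_le_500000)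
    (W : WeierstrassCurve ℚ) [W.IsElliptic] (hj : W.j = -884736) : ClassAbsManinConstantEqOne W := by
  have hΔ : (⟨0, 0, 1, -38, 90⟩ : WeierstrassCurve ℤ).Δ = -((19 : ℤ) ^ 3) := by
    norm_num [WeierstrassCurve.Δ, WeierstrassCurve.b₂, WeierstrassCurve.b₄, WeierstrassCurve.b₆, WeierstrassCurve.b₈]
  have hc₄ : (⟨0, 0, 1, -38, 90⟩ : WeierstrassCurve ℤ).c₄ = 1824 := by
    norm_num [WeierstrassCurve.c₄, WeierstrassCurve.b₂, WeierstrassCurve.b₄]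
  haveI : ((⟨0, 0, 1, -38, 90⟩ : WeierstrassCurve ℤ).baseChange ℚ).IsElliptic :=
    ⟨by rw [WeierstrassCurve.baseChange, WeierstrassCurve.map_Δ, hΔ]; norm_num⟩
  have hjb : ((⟨0, 0, 1, -38, 90⟩ : WeierstrassCurve ℤ).baseChange ℚ).j = -884736 := by
    rw [WeierstrassCurve.j, Units.val_inv_eq_inv_val, WeierstrassCurve.coe_Δ', WeierstrassCurve.baseChange,
      WeierstrassCurve.map_Δ, WeierstrassCurve.map_c₄, hΔ, hc₄]
    norm_num [eq_intCast]
  refine classAbsManinConstantEqOne_of_j_eq_of_disc_support hnf hCre hT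
    ⟨0, 0, 1, -38, 90⟩ (by rw [hjb]; norm_num) (by rw [hjb]; norm_num) {19} (by simp; norm_num) (by simp)
    (fun q hq h ↦ Or.inr ?_) (by simp) W (by rw [hjb, hj])
  rw [hΔ] at h
  simp [prime_eq_of_dvd_neg_pow hq (by norm_num) h]

/-- **`j = −960³` (base 1849a1 `[0,0,1,−860,9707]`, `Δ = −43³`).** [cite: CremonaAlgorithms1997, Table 1 (1849a1) and §3.8] -/
theorem classAbsManinConstantEqOne_of_j_eq_neg_884736000
    (hnf : exists_isNewformOf) (hCre : cremona_abs_maninConstant_eq_one_of_level_le_500000)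
    (W : WeierstrassCurve ℚ) [W.IsElliptic] (hj : W.j = -884736000) : ClassAbsManinConstantEqOne W := by
  have hΔ : (⟨0, 0, 1, -860, 9707⟩ : WeierstrassCurve ℤ).Δ = -((43 : ℤ) ^ 3) := by
    norm_num [WeierstrassCurve.Δ, WeierstrassCurve.b₂, WeierstrassCurve.b₄, WeierstrassCurve.b₆, WeierstrassCurve.b₈]
  have hc₄ : (⟨0, 0, 1, -860, 9707⟩ : WeierstrassCurve ℤ).c₄ = 41280 := by
    norm_num [WeierstrassCurve.c₄, WeierstrassCurve.b₂, WeierstrassCurve.b₄]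
  haveI : ((⟨0, 0, 1, -860, 9707⟩ : WeierstrassCurve ℤ).baseChange ℚ).IsElliptic :=
    ⟨by rw [WeierstrassCurve.baseChange, WeierstrassCurve.map_Δ, hΔ]; norm_num⟩
  have hjb : ((⟨0, 0, 1, -860, 9707⟩ : WeierstrassCurve ℤ).baseChange ℚ).j = -884736000 := by
    rw [WeierstrassCurve.j, Units.val_inv_eq_inv_val, WeierstrassCurve.coe_Δ', WeierstrassCurve.baseChange,
      WeierstrassCurve.map_Δ, WeierstrassCurve.map_c₄, hΔ, hc₄]
    norm_num [eq_intCast]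
  refine classAbsManinConstantEqOne_of_j_eq_of_disc_support hnf hCre hT
    ⟨0, 0, 1, -860, 9707⟩ (by rw [hjb]; norm_num) (by rw [hjb]; norm_num) {43} (by simp; norm_num) (by simp)
    (fun q hq h ↦ Or.inr ?_) (by simp) W (by rw [hjb, hj])
  rw [hΔ] at h
  simp [prime_eq_of_dvd_neg_pow hq (by norm_num) h]

/-- **`j = −7·11³` (base 1225h1 `[1,1,1,−8,6]`, `Δ = −5³7²`).** [cite: CremonaAlgorithms1997, Table 1 (1225h1) and §3.8] -/
theorem classAbsManinConstantEqOne_of_j_eq_neg_9317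
    (hnf : exists_isNewformOf) (hCre : cremona_abs_maninConstant_eq_one_of_level_le_500000)
    (W : WeierstrassCurve ℚ) [W.IsElliptic] (hj : W.j = -9317) : ClassAbsManinConstantEqOne W := by
  have hΔ : (⟨1, 1, 1, -8, 6⟩ : WeierstrassCurve ℤ).Δ = -6125 := by
    norm_num [WeierstrassCurve.Δ, WeierstrassCurve.b₂, WeierstrassCurve.b₄, WeierstrassCurve.b₆, WeierstrassCurve.b₈]
  have hc₄ : (⟨1, 1, 1, -8, 6⟩ : WeierstrassCurve ℤ).c₄ = 385 := by
    norm_num [WeierstrassCurve.c₄, WeierstrassCurve.b₂, WeierstrassCurve.b₄]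
  haveI : ((⟨1, 1, 1, -8, 6⟩ : WeierstrassCurve ℤ).baseChange ℚ).IsElliptic :=
    ⟨by rw [WeierstrassCurve.baseChange, WeierstrassCurve.map_Δ, hΔ]; norm_num⟩
  have hjb : ((⟨1, 1, 1, -8, 6⟩ : WeierstrassCurve ℤ).baseChange ℚ).j = -9317 := by
    rw [WeierstrassCurve.j, Units.val_inv_eq_inv_val, WeierstrassCurve.coe_Δ', WeierstrassCurve.baseChange,
      WeierstrassCurve.map_Δ, WeierstrassCurve.map_c₄, hΔ, hc₄]
    norm_num [eq_intCast]
  exact classAbsManinConstantEqOne_of_j_eq_of_disc_support hnf hCre hT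
    ⟨1, 1, 1, -8, 6⟩ (by rw [hjb]; norm_num) (by rw [hjb]; norm_num) {5, 7} (by simp; norm_num) (by simp)
    (fun q hq h ↦ Or.inr (prime_mem_of_dvd_6125 hq (hΔ ▸ h))) (by simp) W (by rw [hjb, hj])

/-- **`j = −7·137³·2083³` (base 1225h2 `[1,1,1,−208083,−36621194]`, `Δ = −5³7²`).**
[cite: CremonaAlgorithms1997, Table 1 (1225h2) and §3.8] -/
theorem classAbsManinConstantEqOne_of_j_eq_neg_162677523113838677
    (hnf : exists_isNewformOf) (hCre : cremona_abs_maninConstant_eq_one_of_level_le_500000)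
    (W : WeierstrassCurve ℚ) [W.IsElliptic] (hj : W.j = -162677523113838677) : ClassAbsManinConstantEqOne W := by
  have hΔ : (⟨1, 1, 1, -208083, -36621194⟩ : WeierstrassCurve ℤ).Δ = -6125 := by
    norm_num [WeierstrassCurve.Δ, WeierstrassCurve.b₂, WeierstrassCurve.b₄, WeierstrassCurve.b₆, WeierstrassCurve.b₈]
  have hc₄ : (⟨1, 1, 1, -208083, -36621194⟩ : WeierstrassCurve ℤ).c₄ = 9987985 := by
    norm_num [WeierstrassCurve.c₄, WeierstrassCurve.b₂, WeierstrassCurve.b₄]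
  haveI : ((⟨1, 1, 1, -208083, -36621194⟩ : WeierstrassCurve ℤ).baseChange ℚ).IsElliptic :=
    ⟨by rw [WeierstrassCurve.baseChange, WeierstrassCurve.map_Δ, hΔ]; norm_num⟩
  have hjb : ((⟨1, 1, 1, -208083, -36621194⟩ : WeierstrassCurve ℤ).baseChange ℚ).j = -162677523113838677 := by
    rw [WeierstrassCurve.j, Units.val_inv_eq_inv_val, WeierstrassCurve.coe_Δ', WeierstrassCurve.baseChange,
      WeierstrassCurve.map_Δ, WeierstrassCurve.map_c₄, hΔ, hc₄]
    norm_num [eq_intCast]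
  exact classAbsManinConstantEqOne_of_j_eq_of_disc_support hnf hCre hT
    ⟨1, 1, 1, -208083, -36621194⟩ (by rw [hjb]; norm_num) (by rw [hjb]; norm_num) {5, 7} (by simp; norm_num)
    (by simp) (fun q hq h ↦ Or.inr (prime_mem_of_dvd_6125 hq (hΔ ▸ h))) (by simp) W (by rw [hjb, hj])

end Families

end Summit.BirchSwinnertonDyer.BirchSwinnertonDyer.Theorems.TwistFamilyManinDescent

end
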